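import Summits.QuantumFields.QCD.Theorems.SpectralDefectExtinctionWegnerEstimateReduction

/-!
# The resolvent–cell REDUCTION of crux `SpectralDefectExtinction.WegnerEstimate` (item stmt-QuantumFields-8966),
HÖLDER BRANCH

Line `Sketch` (skeleton "ResolventCell"), Hölder branch — the planners' declared repair target if the linear
estimate resists (`wegnerEstimate_imp_holder`, `Theorems/WegnerEstimate/Negative/LoadBearing.lean`: an `ε^α`
Wegner bound, any `α < 1`, still serves the route).  This file is the Hölder twin of the landed linear reduction
`wegnerEstimate_of_localHaarWegner` (p91808): IF the local Haar–Wegner lemma with frozen genuine exterior holds in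
HÖLDER form, `E_V t_x ≤ C ε^{-θ}` with `0 ≤ θ < 1` uniformly in `L ≥ 2`, `x`, the exterior, `m₀ ∈ [−1,0]`,
`ε ∈ (0,1]` (the conclusion of `stub_coareaWegnerHolder`), THEN the Hölder Wegner estimate holds with exponent
`α = 1 − θ ∈ (0,1]`:

  `E N_ε ≤ 2ε Σ_x E t_x ≤ 2ε · L⁴ · C_R (1 + β^{p_R}) · C ε^{-θ} = 2 C_R C (1 + β^{p_R}) ε^{1−θ} L⁴`

via the landed `stub_countLeResolvent` (p87058), `stub_localTraceRegular` (p88424) and `stub_cellAverageBound`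
(p91220).  Sources: Wegner, Z. Phys. B 44 (1981) 9 (`1_{|λ|<ε} ≤ 2ε Im (λ−iε)⁻¹`); E. Seiler, LNP 159 (1982) Ch. 1.
-/

noncomputable section

namespace Summit.QuantumFields.QCD.Cruxes.WegnerEstimate.ResolventCell

open MeasureTheory
open scoped Matrix BigOperators
open Literature.MathematicalPhysics.QuantumLattice Literature.MathematicalPhysics.QuantumFieldTheory
  Literature.Probability.LatticeModels
open Matrix

/-- **The resolvent–cell reduction, Hölder branch.**  IF for some cube radius `R`, constant `C` and exponent
`θ ∈ [0,1)` the Haar average over the links based in `x + box 4 R` (glued into an arbitrary exterior) of the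
site-local trace `t_x = Σ_{a,α} Im ((Γ₅D_W(·,m₀,1) − iε)⁻¹)_{(x,a,α),(x,a,α)}` is `≤ C ε^{-θ}` uniformly in `L ≥ 2`,
`x`, the exterior, `m₀ ∈ [−1,0]` and `ε ∈ (0,1]`, THEN the HÖLDER Wegner estimate holds:
`E N_ε ≤ C' (1 + β^p) ε^α L⁴` with `α = 1 − θ`, `C' = 2 C_R C` and `p = p_R` from `stub_cellAverageBound R`. -/
theorem wegnerEstimateHolder_of_localHaarWegnerHolder
    (hloc : ∃ R : ℕ, ∃ C θ : ℝ, 0 < C ∧ 0 ≤ θ ∧ θ < 1 ∧ ∀ (L : ℕ) [NeZero L], 2 ≤ L →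
      ∀ (x : TorusSite 4 L) (m₀ ε : ℝ), -1 ≤ m₀ → m₀ ≤ 0 → 0 < ε → ε ≤ 1 →
      ∀ U : GaugeConfig 4 L SU3,
        ∫ V, (∑ a : Fin 3, ∑ α : Fin 4,
          (((spinorLift gammaFive * wilsonDirac (fundamentalRep (Fin 3))
              (fun e => if (∃ y ∈ box 4 R, e.1 = x + Torus.proj L y) then V e else U e) m₀ 1 -
            ((ε : ℂ) * Complex.I) • (1 : Matrix (QuarkIdx L) (QuarkIdx L) ℂ))⁻¹ :
              Matrix (QuarkIdx L) (QuarkIdx L) ℂ) (x, a, α) (x, a, α)).im)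
          ∂(Measure.pi fun _ : Edge 4 L => haarProbability SU3) ≤ C * ε ^ (-θ)) :
    ∃ C p α : ℝ, 0 < C ∧ 0 ≤ p ∧ 0 < α ∧ α ≤ 1 ∧ ∀ β : ℝ, 1 ≤ β → ∀ (L : ℕ) [NeZero L], 2 ≤ L →
      ∀ m₀ ε : ℝ, -1 ≤ m₀ → m₀ ≤ 0 → 0 < ε → ε ≤ 1 →
        ∫ U, (Multiset.countP (fun z : ℂ => |z.re| < ε) (spinorLift gammaFive * wilsonDirac (fundamentalRep (Fin 3)) U m₀ 1).charpoly.roots : ℝ) ∂(wilsonMeasure (d := 4) (L := L) (fundamentalRep (Fin 3)) β) ≤ C * (1 + β ^ p) * ε ^ α * (L : ℝ) ^ 4 := by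
  -- adapted from the linear reduction `wegnerEstimate_of_localHaarWegner` (p91808)
  have hcount := stub_countLeResolvent
  have hreg := stub_localTraceRegular
  have hcell := stub_cellAverageBound
  obtain ⟨R, Cloc, θ, hCloc, hθ0, hθ1, hloc⟩ := hloc
  obtain ⟨C₁, p, hC₁, hp, hcell⟩ := hcell R
  refine ⟨2 * C₁ * Cloc, p, 1 - θ, by positivity, hp, by linarith, by linarith, ?_⟩
  intro β hβ L _ hL m₀ ε hm hm' hε hε1
  -- abbreviations
  set μW : Measure (GaugeConfig 4 L SU3) := wilsonMeasure (d := 4) (L := L) (fundamentalRep (Fin 3)) β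
    with hμW
  set t : TorusSite 4 L → GaugeConfig 4 L SU3 → ℝ := fun x U =>
    ∑ a : Fin 3, ∑ α : Fin 4,
      (((spinorLift gammaFive * wilsonDirac (fundamentalRep (Fin 3)) U m₀ 1 -
        ((ε : ℂ) * Complex.I) • (1 : Matrix (QuarkIdx L) (QuarkIdx L) ℂ))⁻¹ :
          Matrix (QuarkIdx L) (QuarkIdx L) ℂ) (x, a, α) (x, a, α)).im
    with ht
  -- pointwise: count ≤ 2ε Σ_x t_x
  have hpt : ∀ U : GaugeConfig 4 L SU3,
      (Multiset.countP (fun z : ℂ => |z.re| < ε)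
        (spinorLift gammaFive * wilsonDirac (fundamentalRep (Fin 3)) U m₀ 1).charpoly.roots : ℝ) ≤
      2 * ε * ∑ x : TorusSite 4 L, t x U := by
    intro U
    have h := hcount L U m₀ ε hε
    rw [reduction_trace_im_eq_sum_sites] at h
    exact h
  -- each local trace is integrable and its Wilson expectation is bounded
  have hint : ∀ x : TorusSite 4 L, Integrable (t x) μW := by
    intro x
    obtain ⟨hcont, hbd⟩ := hreg L x m₀ ε hε
    refine Integrable.of_bound hcont.aestronglyMeasurable (12 / ε) (Filter.Eventually.of_forall fun U => ?_)
    rw [Real.norm_eq_abs, abs_of_nonneg (hbd U).1]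
    exact (hbd U).2
  have hEt : ∀ x : TorusSite 4 L, ∫ U, t x U ∂μW ≤ C₁ * (1 + β ^ p) * (Cloc * ε ^ (-θ)) := by
    intro x
    obtain ⟨hcont, hbd⟩ := hreg L x m₀ ε hε
    exact hcell β hβ L hL x (t x) hcont (fun U => (hbd U).1) (Cloc * ε ^ (-θ))
      (fun U => hloc L hL x m₀ ε hm hm' hε hε1 U)
  -- integrate the pointwise bound
  have hsumInt : Integrable (fun U => 2 * ε * ∑ x : TorusSite 4 L, t x U) μW :=
    (integrable_finsetSum _ fun x _ => hint x).const_mul (2 * ε)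
  have hL4 : (0 : ℝ) ≤ (L : ℝ) ^ 4 := by positivity
  have hεpow : ε * ε ^ (-θ) = ε ^ (1 - θ) := by
    rw [sub_eq_add_neg, Real.rpow_add hε, Real.rpow_one]
  calc ∫ U, (Multiset.countP (fun z : ℂ => |z.re| < ε)
          (spinorLift gammaFive * wilsonDirac (fundamentalRep (Fin 3)) U m₀ 1).charpoly.roots : ℝ) ∂μW
      ≤ ∫ U, 2 * ε * ∑ x : TorusSite 4 L, t x U ∂μW :=
        integral_mono_of_nonneg (Filter.Eventually.of_forall fun U => Nat.cast_nonneg _) hsumInt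
          (Filter.Eventually.of_forall hpt)
    _ = 2 * ε * ∑ x : TorusSite 4 L, ∫ U, t x U ∂μW := by
        rw [integral_const_mul, integral_finsetSum _ fun x _ => hint x]
    _ ≤ 2 * ε * ∑ _x : TorusSite 4 L, C₁ * (1 + β ^ p) * (Cloc * ε ^ (-θ)) := by
        gcongr with x _
        exact hEt x
    _ = 2 * C₁ * Cloc * (1 + β ^ p) * (ε * ε ^ (-θ)) * (L : ℝ) ^ 4 := by
        rw [Finset.sum_const, Finset.card_univ, reduction_card_torusSite, nsmul_eq_mul]
        push_cast
        ring
    _ = 2 * C₁ * Cloc * (1 + β ^ p) * ε ^ (1 - θ) * (L : ℝ) ^ 4 := by rw [hεpow]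

end Summit.QuantumFields.QCD.Cruxes.WegnerEstimate.ResolventCell

end
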